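import Summits.SmoothPoincare4.SmoothPoincare4.Theorems.SullivanDualWitnessChargeHelperMemberGraphFunction
import Summits.SmoothPoincare4.SmoothPoincare4.Theorems.SullivanDualWitnessChargeSubstubFar
import Summits.SmoothPoincare4.SmoothPoincare4.Theorems.SullivanDualWitnessChargeDefs
import Mathlib.Analysis.Complex.Basic

/-!
# Helper `helper_limitProperSep` of line `Sketch` for crux `WitnessCharge`
(item stmt-SmoothPoincare4-7824; route `SullivanDual`, crux
`Summit.SmoothPoincare4.SmoothPoincare4.Theses.SullivanDual.WitnessCharge`; line `Sketch`,
registered stub `helper_limitProperSep` of the lead's cycle-2 helper skeleton, wave 3 —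
(N)-branch: properness, asymptotics and separation of the limit of pencil members)

**Properness, asymptotics and separation of the limit.** Let `G : ℂ → Σ∖p` be continuous (the
limit of a sequence of pencil members), and suppose that on the far part `‖ξ‖ > 2R` (`R > ε'⁻¹`)
it lies in the punctured `ε'`-chart-ball `B_{ε'}` with complex flat coordinates
`Ycoord p (G ξ) = (z, w)` subject to the four quantitative bounds inherited from the members:
covering (`G ξ ∈ B_{ε'}`, `‖z‖ ≥ R` for `‖ξ‖ > 2R`), decay (`‖z − ξ‖ ≤ 48R²/‖ξ‖` for `‖ξ‖ ≥ 4R`),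
tail (`‖w − b⋆‖ ≤ C/‖z‖` for `‖ξ‖ > 2R`) and the near bound (`‖z‖ ≤ 2r` on
`{‖ξ‖ ≤ r} ∩ G⁻¹(B_{ε'})` for `r ≥ 2R`). Then

* `G` is PROPER (preimages of compact sets are compact);
* `z − ξ → 0` and `w → b⋆` along `cocompact ℂ`;
* SEPARATION: `G ξ ≠ G ξ'` whenever `‖ξ‖ ≤ r`, `‖ξ'‖ ≥ 2r + 12R + 1`, `r ≥ 2R`.

Proof — elementary real-inequality bookkeeping over two landed lemmas. The decay bound gives the
LOWER BOUND `‖z‖ ≥ ‖ξ‖ − 48R²/‖ξ‖ ≥ ‖ξ‖ − 12R` for `‖ξ‖ ≥ 4R` (`norm_sub_twelve_le`). Hence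
`‖z − ξ‖ ≤ 48R²/‖ξ‖ → 0` and `‖w − b⋆‖ ≤ C/‖z‖ ≤ 2C/‖ξ‖ → 0` (for `‖ξ‖ ≥ 24R`) along
`cocompact ℂ` (`tendsto_norm_cocompact_atTop`, `Filter.Tendsto.div_atTop`, squeezing). Properness:
a compact `K ⊆ Σ∖p` misses a punctured chart-ball `B_ρ` (`exists_ball_disjoint_of_isCompact`), and
for `‖ξ‖ > max (4R) (12R + ρ⁻¹)` one has `G ξ ∈ B_{ε'}` with `‖z‖ > ρ⁻¹`, so `G ξ ∈ B_ρ`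
(`inBall_of_inv_lt_norm_fst_Ycoord`) and `G ξ ∉ K`; thus `G⁻¹(K)` is a closed subset of a closed
disc. Separation: `‖z'‖ ≥ ‖ξ'‖ − 12R ≥ 2r + 1` at `ξ'`, while `G ξ = G ξ'` would put `G ξ` in
`B_{ε'}` with `‖z‖ = ‖z'‖ ≤ 2r` by the near bound.
-/

noncomputable section

-- the registered namespace `Summit.SmoothPoincare4.SmoothPoincare4.…` repeats a component
set_option linter.dupNamespace false

open scoped Manifold ContDiff Topology
open Set Filter Literature.Geometry.Kaehler Literature.Geometry.Symplectic
  Literature.Topology.FourManifolds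

namespace Summit.SmoothPoincare4.SmoothPoincare4.Theorems.WitnessCharge.PencilIncompleteness

/-! ### Real-inequality bookkeeping: the lower bound for the first flat coordinate -/

/-- The decay bound `48 R² / t` is at most `12 R` once `t ≥ 4R` (`R > 0`). -/
theorem decay_bound_le_twelve {R t : ℝ} (hR : 0 < R) (ht : 4 * R ≤ t) :
    48 * R ^ 2 / t ≤ 12 * R := by
  have htpos : 0 < t := by linarith
  rw [div_le_iff₀ htpos]
  nlinarith

/-- LOWER BOUND for the first flat coordinate: if `‖z − ξ‖ ≤ 48R²/‖ξ‖` and `‖ξ‖ ≥ 4R`, `R > 0`,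
then `‖ξ‖ − 12 R ≤ ‖z‖`. -/
theorem norm_sub_twelve_le {R : ℝ} (hR : 0 < R) {ξ z : ℂ} (hξ : 4 * R ≤ ‖ξ‖)
    (hz : ‖z - ξ‖ ≤ 48 * R ^ 2 / ‖ξ‖) : ‖ξ‖ - 12 * R ≤ ‖z‖ := by
  have h1 : ‖z - ξ‖ ≤ 12 * R := hz.trans (decay_bound_le_twelve hR hξ)
  have h2 : ‖ξ‖ - ‖z‖ ≤ ‖z - ξ‖ := by
    rw [norm_sub_rev]
    exact norm_sub_norm_le ξ z
  linarith

/-! ### The helper -/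

/-- **Properness, asymptotics and separation of the limit ((N)-branch).** For a continuous
`G : ℂ → Σ∖p` whose far part `‖ξ‖ > 2R` (`R > ε'⁻¹ > 0`) lies in the punctured `ε'`-chart-ball
with flat coordinates `(z, w) = Ycoord p (G ξ)` satisfying the covering bound `‖z‖ ≥ R`, the decay
`‖z − ξ‖ ≤ 48R²/‖ξ‖` (`‖ξ‖ ≥ 4R`), the tail bound `‖w − b⋆‖ ≤ C/‖z‖` (`C ≥ 0`) and the near bound
`‖z‖ ≤ 2r` on `{‖ξ‖ ≤ r} ∩ G⁻¹(B_{ε'})` (`r ≥ 2R`): `G` is proper, `z − ξ → 0` and `w → b⋆` along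
`cocompact ℂ`, and `G ξ ≠ G ξ'` for `‖ξ‖ ≤ r`, `‖ξ'‖ ≥ 2r + 12R + 1`, `r ≥ 2R`. All four follow
from the lower bound `‖z‖ ≥ ‖ξ‖ − 12R` (`‖ξ‖ ≥ 4R`, `norm_sub_twelve_le`), the disjointness of
compact sets from small punctured chart-balls (`exists_ball_disjoint_of_isCompact`,
`inBall_of_inv_lt_norm_fst_Ycoord`) and squeezing against `c/‖ξ‖ → 0`
(`tendsto_norm_cocompact_atTop`). -/
theorem helper_limitProperSep :
    ∀ (S : HomotopySphere 4) (p : S.carrier) (ε' : ℝ), 0 < ε' →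
      ∀ (G : ℂ → punctured p), Continuous G → ∀ (bstar : ℂ) (R C : ℝ), ε'⁻¹ < R → 0 ≤ C →
        (∀ ξ : ℂ, 2 * R < ‖ξ‖ → InPuncturedChartBall p ε' (G ξ) ∧ R ≤ ‖(Ycoord p (G ξ)).1‖) →
        (∀ ξ : ℂ, 4 * R ≤ ‖ξ‖ → ‖(Ycoord p (G ξ)).1 - ξ‖ ≤ 48 * R ^ 2 / ‖ξ‖) →
        (∀ ξ : ℂ, 2 * R < ‖ξ‖ → ‖(Ycoord p (G ξ)).2 - bstar‖ ≤ C / ‖(Ycoord p (G ξ)).1‖) →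
        (∀ r : ℝ, 2 * R ≤ r → ∀ ξ : ℂ, ‖ξ‖ ≤ r → InPuncturedChartBall p ε' (G ξ) →
          ‖(Ycoord p (G ξ)).1‖ ≤ 2 * r) →
        (∀ K : Set (punctured p), IsCompact K → IsCompact (G ⁻¹' K)) ∧
          Tendsto (fun ξ : ℂ => (Ycoord p (G ξ)).1 - ξ) (cocompact ℂ) (𝓝 0) ∧
          Tendsto (fun ξ : ℂ => (Ycoord p (G ξ)).2) (cocompact ℂ) (𝓝 bstar) ∧
          (∀ r : ℝ, 2 * R ≤ r → ∀ ξ ξ' : ℂ, ‖ξ‖ ≤ r → 2 * r + 12 * R + 1 ≤ ‖ξ'‖ → G ξ ≠ G ξ') := by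
  intro S p ε' hε' G hG bstar R C hR hC hcov hdecay htail hnear
  have hR0 : 0 < R := (inv_pos.2 hε').trans hR
  -- (a) the lower bound `‖ξ‖ - 12 R ≤ ‖z‖` for `‖ξ‖ ≥ 4R`
  have hlow : ∀ ξ : ℂ, 4 * R ≤ ‖ξ‖ → ‖ξ‖ - 12 * R ≤ ‖(Ycoord p (G ξ)).1‖ := fun ξ hξ =>
    norm_sub_twelve_le hR0 hξ (hdecay ξ hξ)
  -- eventually `c ≤ ‖ξ‖` along `cocompact ℂ`, and `c / ‖ξ‖ → 0` there
  have hev : ∀ c : ℝ, ∀ᶠ ξ : ℂ in cocompact ℂ, c ≤ ‖ξ‖ := fun c =>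
    tendsto_norm_cocompact_atTop.eventually_ge_atTop c
  have hdiv : ∀ c : ℝ, Tendsto (fun ξ : ℂ => c / ‖ξ‖) (cocompact ℂ) (𝓝 0) := fun c =>
    tendsto_const_nhds.div_atTop tendsto_norm_cocompact_atTop
  refine ⟨?_, ?_, ?_, ?_⟩
  · -- (d) properness: `G ⁻¹' K` is closed and contained in a closed disc
    intro K hK
    obtain ⟨ρ, hρ, hρK⟩ := exists_ball_disjoint_of_isCompact hK
    have hclosed : IsClosed (G ⁻¹' K) := hK.isClosed.preimage hG
    refine (isCompact_closedBall (0 : ℂ) (max (4 * R) (12 * R + ρ⁻¹))).of_isClosed_subset hclosed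
      fun ξ hξ => ?_
    rw [mem_closedBall_zero_iff]
    refine le_of_not_gt fun hlt => ?_
    have h4 : 4 * R ≤ ‖ξ‖ := (le_max_left _ _).trans hlt.le
    have h12 : 12 * R + ρ⁻¹ < ‖ξ‖ := (le_max_right _ _).trans_lt hlt
    have h2 : 2 * R < ‖ξ‖ := by linarith
    have hz : ρ⁻¹ < ‖(Ycoord p (G ξ)).1‖ := by linarith [hlow ξ h4]
    exact hρK (G ξ) (inBall_of_inv_lt_norm_fst_Ycoord (hcov ξ h2).1 hρ hz) hξ
  · -- (b) `z - ξ → 0`: squeeze against `48 R² / ‖ξ‖ → 0`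
    refine squeeze_zero_norm' ?_ (hdiv (48 * R ^ 2))
    filter_upwards [hev (4 * R)] with ξ hξ
    exact hdecay ξ hξ
  · -- (c) `w → b⋆`: `‖w - b⋆‖ ≤ C / ‖z‖ ≤ 2C / ‖ξ‖` for `‖ξ‖ ≥ 24R`
    rw [tendsto_iff_norm_sub_tendsto_zero]
    refine squeeze_zero' (Eventually.of_forall fun ξ => norm_nonneg _) ?_ (hdiv (2 * C))
    filter_upwards [hev (24 * R)] with ξ hξ
    have h4 : 4 * R ≤ ‖ξ‖ := by linarith
    have h2 : 2 * R < ‖ξ‖ := by linarith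
    have hzl : ‖ξ‖ ≤ 2 * ‖(Ycoord p (G ξ)).1‖ := by linarith [hlow ξ h4]
    have hξpos : 0 < ‖ξ‖ := by linarith
    have hzpos : 0 < ‖(Ycoord p (G ξ)).1‖ := by linarith
    calc ‖(Ycoord p (G ξ)).2 - bstar‖ ≤ C / ‖(Ycoord p (G ξ)).1‖ := htail ξ h2
      _ ≤ 2 * C / ‖ξ‖ := by
        rw [div_le_div_iff₀ hzpos hξpos]
        nlinarith [mul_le_mul_of_nonneg_left hzl hC]
  · -- (e) separation: `‖z'‖ ≥ 2r + 1` at `ξ'`, `‖z‖ ≤ 2r` at `ξ` by the near bound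
    intro r hr ξ ξ' hξ hξ' heq
    have h4 : 4 * R ≤ ‖ξ'‖ := by linarith
    have h2 : 2 * R < ‖ξ'‖ := by linarith
    have hz' : 2 * r + 1 ≤ ‖(Ycoord p (G ξ')).1‖ := by linarith [hlow ξ' h4]
    have hball : InPuncturedChartBall p ε' (G ξ) := by
      rw [heq]
      exact (hcov ξ' h2).1
    have hz : ‖(Ycoord p (G ξ)).1‖ ≤ 2 * r := hnear r hr ξ hξ hball
    rw [heq] at hz
    linarith

end Summit.SmoothPoincare4.SmoothPoincare4.Theorems.WitnessCharge.PencilIncompleteness
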